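import Literature.NumberTheory.EllipticCurves.NeronModelProofs
import Literature.NumberTheory.DiophantineGeometry.MinimalDiscriminantNormProofs
import HarnessLib

/-!
# `ord_v j(E) = -ord_v(Δ_min)` at a place of multiplicative reduction, over any Dedekind domain

`Proofs` file (theorems only: no definition, no named fact), topic `NumberTheory/EllipticCurves`.
J. H. Silverman, *The Arithmetic of Elliptic Curves*, 2nd ed., GTM 106 (2009), Prop. VII.5.1 (b): a
minimal Weierstrass equation has multiplicative reduction iff `v(Δ) > 0` and `v(c₄) = 0`; since
`j · Δ = c₄³`, at such a place `v(j) = -v(Δ_min) < 0`, i.e. `|j|_v > 1` (the hypothesis of Tate's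
theorem, Silverman *ATAEC* V.5.3, and the dictionary "local height `h_v` = order of the `q`-parameter
`= ord_v(Δ_min) = -ord_v(j)`" of [GenEll] Def. 3.3 / [IUTchI] Def. 3.1 (c) / [IUTchIV] Cor. 2.2 p. 44).

The tree proves this for `W/ℚ` (`Literature.NumberTheory.EllipticCurves.ModularForms.valuation_j_eq_exp_ordMinimalDiscriminant`,
file `PastenHeightBoundsLemma68LocalProofs`, whose proof is followed verbatim); here it is stated for a
Weierstrass curve over the fraction field `K` of ANY Dedekind domain `A` at any finite place `v`
(so in particular for number fields, as the abc-iut consumers need):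

* `WeierstrassCurve.valuation_j_eq_exp_ordMinimalDiscriminant_of_hasMultiplicativeReductionAt` —
  `v(j(W)) = exp(ord_v Δ_min(W))` in `ℤᵐ⁰` (value `exp(-ord_v)` convention of `v.valuation K`);
* `WeierstrassCurve.j_ne_zero_of_hasMultiplicativeReductionAt` — `j(W) ≠ 0` (and `|j(W)|_v > 1`);
* `WeierstrassCurve.log_valuation_j_eq_ordMinimalDiscriminant_of_hasMultiplicativeReductionAt` —
  the integer form `log (v(j)) = ord_v(Δ_min)`, i.e. `-ord_v(j) = ord_v(Δ_min)`, and
  `WeierstrassCurve.natCast_dvd_neg_log_valuation_j_iff` — for `n : ℕ`,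
  `(n : ℤ) ∣ -log v(j) ↔ n ∣ ord_v(Δ_min)` (the form in which "`l ∤ h_v`" of [GenEll] Lem. 3.5 /
  [IUTchIV] Cor. 2.2 (P2) is transported to `ordMinimalDiscriminant`).

## References

* [SilvermanAEC2009] J. H. Silverman, *The Arithmetic of Elliptic Curves*, 2nd ed. (2009),
  Prop. VII.5.1 (b), VII.1.
* [SilvermanATAEC1994] J. H. Silverman, *Advanced Topics*, GTM 151 (1994), V.5 Lemma 5.1, Thm. 5.3.
-/

noncomputable section

open IsDedekindDomain

namespace WeierstrassCurve

variable {A : Type*} [CommRing A] [IsDedekindDomain A] {K : Type*} [Field K] [Algebra A K]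
  [IsFractionRing A K] (v : HeightOneSpectrum A) (W : WeierstrassCurve K)

/-- **`|j(W)|_v = exp(ord_v Δ_min(W))` at a place of multiplicative reduction** (Silverman, *AEC*,
Prop. VII.5.1 (b): a minimal equation at `v` with multiplicative reduction has `v(c₄) = 0`,
`v(Δ) = ord_v Δ_min > 0`, and `j · Δ = c₄³`; so `ord_v j = −ord_v Δ_min`), for a Weierstrass curve over
the fraction field `K` of a Dedekind domain `A` and a finite place `v` of `A`; `v.valuation K` has values
`exp(−ord_v)`, and the computation runs in the completion `K_v` on the local minimal model
`W.localMinimalModel v` (verbatim the tree's `ℚ`-proof). [cite: SilvermanAEC2009, Prop. VII.5.1(b)] -/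
theorem valuation_j_eq_exp_ordMinimalDiscriminant_of_hasMultiplicativeReductionAt [W.IsElliptic]
    (hv : W.HasMultiplicativeReductionAt v) :
    v.valuation K W.j = WithZero.exp (W.ordMinimalDiscriminant v : ℤ) := by
  haveI := W.isElliptic_localMinimalModel v
  haveI hb : (W.baseChange (v.adicCompletion K)).IsElliptic := by
    unfold baseChange; infer_instance
  set Kv := v.adicCompletion K
  set E := W.localMinimalModel v with hE
  have hm : E.HasMultiplicativeReduction (v.adicCompletionIntegers K) := hv
  -- `j(E) = j(W)` in `K_v` (`E` is a change of variables of `W ⊗ K_v`, and `j` is invariant)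
  have hjE : E.j = algebraMap K Kv W.j := by
    change (((W.baseChange Kv).exists_isMinimal (v.adicCompletionIntegers K)).choose •
        W.baseChange Kv).j = _
    rw [variableChange_j]
    exact W.map_j _
  -- `Δ(E)` comes from the integral model; its order is `ord_v Δ_min`
  set d : v.adicCompletionIntegers K := (W.localMinimalIntegralModel v).Δ with hd
  have hdK : algebraMap _ Kv d = E.Δ := WeierstrassCurve.integralModel_Δ_eq _ _
  have hd0 : d ≠ 0 := by
    intro h0
    have := (WeierstrassCurve.isUnit_Δ (W := E)).ne_zero
    rw [← hdK, h0, map_zero] at this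
    exact this rfl
  obtain ⟨n, hn, hvn⟩ := HeightOneSpectrum.exists_addVal_adicCompletionIntegers_eq K v d hd0
  have hord : W.ordMinimalDiscriminant v = n := by
    rw [WeierstrassCurve.ordMinimalDiscriminant, ← hd, hn]
    rfl
  -- `c₄(E)` is a unit: `Valued.v c₄ = 1`
  have hequiv := WeierstrassCurve.isEquiv_valuation_maximalIdeal_of_le_one_iff
    (WeierstrassCurve.valued_le_one_iff_mem_range_adicCompletionIntegers v (K := K))
  have hc₄ : (Valued.v : Valuation Kv (WithZero (Multiplicative ℤ))) E.c₄ = 1 :=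
    (Valuation.isEquiv_iff_val_eq_one.mp hequiv).mp hm.multiplicativeReduction
  -- `j · Δ = c₄³`
  have key : algebraMap K Kv W.j * E.Δ = E.c₄ ^ 3 := by
    rw [← hjE, WeierstrassCurve.j, ← WeierstrassCurve.coe_Δ', mul_comm, ← mul_assoc,
      Units.mul_inv, one_mul]
  have hval := congrArg (Valued.v : Valuation Kv (WithZero (Multiplicative ℤ))) key
  rw [map_mul, map_pow, hc₄, one_pow, ← hdK] at hval
  change Valued.v (algebraMap K Kv W.j) * Valued.v (d : Kv) = 1 at hval
  rw [hvn, WeierstrassCurve.valued_algebraMap_adicCompletion] at hval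
  rw [eq_inv_of_mul_eq_one_left hval, hord, WithZero.exp_neg, inv_inv]

/-- `j(W) ≠ 0` as soon as there is a place of multiplicative reduction (`v(j) = exp(ord_v Δ_min) ≠ 0`;
the strict inequality `|j|_v > 1` follows likewise from `ord_v Δ_min ≥ 1`,
`ordMinimalDiscriminant_ne_zero_of_hasMultiplicativeReductionAt`). [cite: SilvermanAEC2009, Prop. VII.5.1(b)] -/
theorem j_ne_zero_of_hasMultiplicativeReductionAt [W.IsElliptic] (hv : W.HasMultiplicativeReductionAt v) :
    W.j ≠ 0 := by
  intro h0
  have h := W.valuation_j_eq_exp_ordMinimalDiscriminant_of_hasMultiplicativeReductionAt v hv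
  rw [h0, map_zero] at h
  exact WithZero.coe_ne_zero h.symm

/-- **Integer form: `log v(j(W)) = ord_v(Δ_min)`**, i.e. `-ord_v(j) = ord_v(Δ_min)` with
`ord_v := -log ∘ v.valuation K` (the convention of `Literature.IUT.LogVolume.ord`; so the local height
`-ord_v(j)` of [GenEll] Def. 3.3 IS `ord_v(Δ_min)` at a multiplicative place).
[cite: SilvermanAEC2009, Prop. VII.5.1(b)] -/
theorem log_valuation_j_eq_ordMinimalDiscriminant_of_hasMultiplicativeReductionAt [W.IsElliptic]
    (hv : W.HasMultiplicativeReductionAt v) :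
    WithZero.log (v.valuation K W.j) = (W.ordMinimalDiscriminant v : ℤ) := by
  rw [W.valuation_j_eq_exp_ordMinimalDiscriminant_of_hasMultiplicativeReductionAt v hv, WithZero.log_exp]

/-- For `n : ℕ`: `(n : ℤ) ∣ -(-log v(j))`-style bookkeeping — `(n : ℤ)` divides the local height
`-ord_v(j) = log v(j)` iff `n ∣ ord_v(Δ_min)` (how "`l ∤ h_v`", [GenEll] Lem. 3.5 / [IUTchIV] Cor. 2.2
(P2), is read on `WeierstrassCurve.ordMinimalDiscriminant`). [cite: SilvermanAEC2009, Prop. VII.5.1(b)] -/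
theorem natCast_dvd_log_valuation_j_iff [W.IsElliptic] (hv : W.HasMultiplicativeReductionAt v) (n : ℕ) :
    (n : ℤ) ∣ WithZero.log (v.valuation K W.j) ↔ n ∣ W.ordMinimalDiscriminant v := by
  rw [W.log_valuation_j_eq_ordMinimalDiscriminant_of_hasMultiplicativeReductionAt v hv, Int.natCast_dvd_natCast]

end WeierstrassCurve

end
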